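import Summits.QuantumFields.BalabanUV.Beta.FP.PerfectColumnSemigroup
import Summits.QuantumFields.BalabanUV.Beta.FP.StepLawKHolds

/-!
# `BalabanUV.Beta.FP.ColumnSemigroupVertexNesting` — road «FP» for binder row D1, W-ORACLE-K row **TRANSPORT** (§11d; first refusal leaf-02), located
# fact (F-V) of L-d1leaf02g15-1: A COLUMN SEMIGROUP NESTS THE CHAIN-RULE VERTICES —
# `colH A N′ = colH B L ∘ lift(colH C M)` ⟹ `vertexOfK A N′ S = vertexOfK C M (vertexOfK B L S)`; instance: the UNDRESSED perfect resolvents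
# `vertexOfK (KPerf (m+1)) (Lc^(m+1)) S = vertexOfK (KPerf m) (Lc^m) (vertexOfK (KPerf 1) Lc S)` from the OWNER's (K-fm) `kPerf_column_semigroup`

HONEST DEPENDENCY (page 1, mandatory): continuum YM on T⁴ ⇐ BetaPertH ∧ nine spine estimates (0/9 proved); BetaPertH ⇐ (D1) ∧ (D4) ∧ CAP+tail;
G-an2-4 gates asym, D1 and NE2/3/4.  HONEST FRAMING (cell contract, verbatim): «discharging `BetaPertH` makes Bałaban's UV stability UNCONDITIONAL —
a real constructive-QFT result; it is NOT the continuum limit and NOT the Clay problem.»  THIS MODULE is [folklore] Fubini bookkeeping of absolutely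
convergent superpositions (§1, generic `d`, generic kernels) + [our object] ONE instance over the OWNER's `PerfectColumnSemigroup.kPerf_column_semigroup` and
`StepLawKHolds.exists_decays_KPerf_holds` BY NAME (§2, `d + 1 = 4`, `Lc ≥ 2`).  No `def`, no `def … : Prop`, nothing cited, 0 sorry; 0∕4 row-D1 binders;
NOT TRANSPORT (one located letter of it), NOT SDF, NOT D1, NOT BetaPertH, NOT continuum, NOT Clay.  «not in print; our bookkeeping».

ABSOLUTE RULE (cell charter, verbatim): «No internally-minted statement may enter as a cited fact. Every hypothesis is either kernel-proved in this package or a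
verbatim quotation of a PUBLISHED theorem with page reference. The manuscript(s) under audit are NOT citable for their own disputed steps — they are the thing
under adjudication; programme-internal (2001/route/tribunal) claims are never citable.»

WHY (memo `N2B-DESIGN.md` §11 (11d), journal l.34473; my located note L-d1leaf02g15-1 l.35286).  Row TRANSPORT reads the level-`(m+1)` vertex
`V′ = vertexOfK G_N N′ S∞` as a superposition of LEVEL-1 vertices weighted by the columns of the `m`-fold resolvent: «`V′_{μ,y} = Σ_{b₁} c_m(b₁; μ,y)·V₁(b₁)`».
With an4's `vertexOfK K N S μ y = Σ_{κ′} wsum (colH K N μ y κ′) (S κ′)` this is LITERALLY a nesting `vertexOfK C M (vertexOfK B L S)` — the level-1 vertex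
family `vertexOfK B L S : Fin (d+1) → Site → MKer` taken AS THE STENCIL FAMILY of the outer vertex (indexed by the `L`-lattice coordinates of its coarse bonds) —
as soon as the columns compose: `colH A N′ μ z′ κ x′ = Σ'_{w′} Σ_{l″} colH B L l″ w′ κ x′ · colH C M μ z′ l″ w′` (the OWNER's (K-fm) for the undressed perfect
resolvents; leaf-06's SPLIT (ii)∕(iii) laws supply the Π-dressed currency).  §1 is that Fubini step for ANY bounded stencil family (so it nests twice, for
`vertex2OfK`, whose inner family is a vertex family, not a local stencil); §2 the undressed perfect instance.

CONTENT.
* §1 [folklore] `summable_colH_colH_shear` (the `(w′, x′)`-double series `colH B L l″ w′ κ x′ · colH C M μ z′ l″ w′ · S κ x′ …` is absolutely summable for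
  decaying `B`, `C` and bounded `S` — shear `x′ ↦ x′ − L•w′`), **`vertexOfK_nest_of_columns`** (`vertexOfK A N′ S = vertexOfK C M (vertexOfK B L S)`),
  **`vertex2OfK_nest_of_columns`** (the bi-vertex nests the same way, twice).
* §2 [our object] **`vertexOfK_KPerf_succ_eq_nest`** ∕ **`vertex2OfK_KPerf_succ_eq_nest`** (`d + 1 = 4`, `2 ≤ Lc`, `1 ≤ m`; UNDRESSED perfect resolvents in the
  adopted units; any bounded stencil ∕ bi-stencil family).
Provenance: unit `b2b-balaban-beta-d1-formalise-leaf-02` gen 15 (prover-b2b-balaban-beta-d1-formalise-leaf-02-g15-0), 2026-08-21; new file, nothing appended to others' modules.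
-/

noncomputable section

namespace Summit.QuantumFields.BalabanUV.Beta.FP.ColumnSemigroupVertexNesting

open Finset Filter Topology
open scoped BigOperators
open Literature.MathematicalPhysics.QuantumFieldTheory.Balaban1983to89
open Literature.MathematicalPhysics.QuantumFieldTheory.Balaban1983to89.Beta
open B12Sec2to5 (l1 l1_nonneg)
open ExpKernelCalculus (MKer Decays summable_exp_shift')
open OneStepResolventKernel (Fib wsum)
open OneStepKernelFamily (colH vertexOfK abs_colH_le)
open SecondOrderResponse (vertex2OfK)
open KKTFluctuationEnergy (summable_mul_of_bdd)
open Summit.QuantumFields.BalabanUV.Beta.GAN24.CombesThomas (sfStep smStep)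
open Summit.QuantumFields.BalabanUV.Beta.FP.PerfectObjectsT (KPerf)
open Summit.QuantumFields.BalabanUV.Beta.FP.PerfectColumnSemigroup (kPerf_column_semigroup)
open Summit.QuantumFields.BalabanUV.Beta.FP.StepLawKHolds (exists_decays_KPerf_holds)

/-! ## §1 Generic: a column semigroup nests the chain-rule vertices -/

section Generic

variable {d : ℕ} {A B C : MKer (d + 1) (Fib d)} {N' L M : ℕ} {CB δB CC δC Cs : ℝ}
  {S : Fin (d + 1) → (Fin (d + 1) → ℤ) → MKer (d + 1) (Fib d)}

/-- [folklore] The sheared double exponential `e^{−δC|w′ − q|}·e^{−δB|x′ − L•w′|}` is summable over `(w′, x′)` (shear `x′ ↦ x′ − L•w′`, then a product of two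
summable one-variable series). -/
theorem summable_exp_shear (hδB : 0 < δB) (hδC : 0 < δC) (Lz : ℤ) (q : Fin (d + 1) → ℤ) (K : ℝ) :
    Summable fun p : (Fin (d + 1) → ℤ) × (Fin (d + 1) → ℤ) =>
      K * (Real.exp (-δC * l1 (p.1 - q)) * Real.exp (-δB * l1 (p.2 - Lz • p.1))) := by
  -- the product series in the sheared variables `(w′, u)`, `u = x′ − L•w′`
  have hprod : Summable fun p : (Fin (d + 1) → ℤ) × (Fin (d + 1) → ℤ) =>
      Real.exp (-δC * l1 (p.1 - q)) * Real.exp (-δB * l1 (p.2 - 0)) :=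
    Summable.mul_of_nonneg (summable_exp_shift' hδC q) (summable_exp_shift' hδB 0)
      (fun _ => (Real.exp_pos _).le) (fun _ => (Real.exp_pos _).le)
  -- the shear `(w′, u) ↦ (w′, u + L•w′)`
  let e : (Fin (d + 1) → ℤ) × (Fin (d + 1) → ℤ) ≃ (Fin (d + 1) → ℤ) × (Fin (d + 1) → ℤ) :=
    Equiv.prodShear (Equiv.refl _) (fun w' => Equiv.addRight (Lz • w'))
  have hcomp : (fun p : (Fin (d + 1) → ℤ) × (Fin (d + 1) → ℤ) =>
        Real.exp (-δC * l1 (p.1 - q)) * Real.exp (-δB * l1 (p.2 - Lz • p.1))) ∘ e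
      = fun p => Real.exp (-δC * l1 (p.1 - q)) * Real.exp (-δB * l1 (p.2 - 0)) := by
    funext p
    simp only [Function.comp_apply, e, Equiv.prodShear_apply, Equiv.refl_apply, Equiv.coe_addRight, add_sub_cancel_right, sub_zero]
  have h := (e.summable_iff (f := fun p : (Fin (d + 1) → ℤ) × (Fin (d + 1) → ℤ) =>
    Real.exp (-δC * l1 (p.1 - q)) * Real.exp (-δB * l1 (p.2 - Lz • p.1)))).mp (by rw [hcomp]; exact hprod)
  exact h.mul_left K

/-- [folklore] **THE DOUBLE SERIES OF THE NESTED VERTEX IS ABSOLUTELY SUMMABLE**: for decaying `B` (rate `δB > 0`), `C` (rate `δC > 0`) and a uniformly bounded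
stencil family `S`, at every entry `(x, z, a, b)` the function `(w′, x′) ↦ colH B L l″ w′ κ x′ · colH C M μ z′ l″ w′ · S κ x′ x z a b` is summable. -/
theorem summable_colH_colH (hB : Decays B CB δB) (hδB : 0 < δB) (hC : Decays C CC δC) (hδC : 0 < δC)
    (hS : ∀ κ u x z a b, |S κ u x z a b| ≤ Cs) (μ : Fin (d + 1)) (z' : Fin (d + 1) → ℤ) (κ l'' : Fin (d + 1))
    (x z : Fin (d + 1) → ℤ) (a b : Fib d) :
    Summable fun p : (Fin (d + 1) → ℤ) × (Fin (d + 1) → ℤ) =>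
      colH C M μ z' l'' p.1 * colH B L l'' p.1 κ p.2 * S κ p.2 x z a b := by
  have hCB : 0 ≤ CB := hB.nonneg (Sum.inl 0)
  have hCC : 0 ≤ CC := hC.nonneg (Sum.inl 0)
  have hCs : 0 ≤ Cs := (abs_nonneg _).trans (hS κ 0 0 0 (Sum.inl 0) (Sum.inl 0))
  refine Summable.of_norm_bounded (summable_exp_shear (d := d) hδB hδC (L : ℤ) ((M : ℤ) • z') (CC * CB * Cs)) (fun p => ?_)
  rw [Real.norm_eq_abs, abs_mul, abs_mul]
  have h1 := abs_colH_le (N := M) hC μ z' l'' p.1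
  have h2 := abs_colH_le (N := L) hB l'' p.1 κ p.2
  have h3 := hS κ p.2 x z a b
  have e2 : (p.2 - ((L : ℕ) : ℤ) • p.1) = (p.2 - (L : ℤ) • p.1) := rfl
  calc |colH C M μ z' l'' p.1| * |colH B L l'' p.1 κ p.2| * |S κ p.2 x z a b|
      ≤ (CC * Real.exp (-δC * l1 (p.1 - (M : ℤ) • z'))) * (CB * Real.exp (-δB * l1 (p.2 - (L : ℤ) • p.1))) * Cs := by
        gcongr
    _ = CC * CB * Cs * (Real.exp (-δC * l1 (p.1 - (M : ℤ) • z')) * Real.exp (-δB * l1 (p.2 - (L : ℤ) • p.1))) := by ring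

/-- [folklore] **A COLUMN SEMIGROUP NESTS THE CHAIN-RULE VERTICES.**  If the `ℋ`-columns of `A` at blocking `N′` compose from those of `B` at blocking `L` and of
`C` at blocking `M` — `colH A N′ μ z′ κ x′ = Σ'_{w′} Σ_{l″} colH B L l″ w′ κ x′ · colH C M μ z′ l″ w′` (the intermediate bonds `(l″, w′)` in `L`-lattice coordinates) —
then for every uniformly bounded stencil family `S`, `vertexOfK A N′ S μ z′ = vertexOfK C M (vertexOfK B L S) μ z′`: the outer vertex's «stencil family» IS the
family of inner vertices indexed by their coarse bonds.  Pure Fubini (`summable_colH_colH`). -/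
theorem vertexOfK_nest_of_columns (hB : Decays B CB δB) (hδB : 0 < δB) (hC : Decays C CC δC) (hδC : 0 < δC)
    (hS : ∀ κ u x z a b, |S κ u x z a b| ≤ Cs)
    (hcol : ∀ (μ : Fin (d + 1)) (z' : Fin (d + 1) → ℤ) (κ : Fin (d + 1)) (x' : Fin (d + 1) → ℤ),
      colH A N' μ z' κ x' = ∑' w' : Fin (d + 1) → ℤ, ∑ l'' : Fin (d + 1), colH B L l'' w' κ x' * colH C M μ z' l'' w')
    (μ : Fin (d + 1)) (z' : Fin (d + 1) → ℤ) :
    vertexOfK A N' S μ z' = vertexOfK C M (vertexOfK B L S) μ z' := by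
  funext x z a b
  -- the summable kernel of the computation, per `(κ, l″)`, on the `(w′, x′)`-pairs
  set f : Fin (d + 1) → Fin (d + 1) → (Fin (d + 1) → ℤ) × (Fin (d + 1) → ℤ) → ℝ :=
    fun κ l'' p => colH C M μ z' l'' p.1 * colH B L l'' p.1 κ p.2 * S κ p.2 x z a b with hf
  have hsum : ∀ κ l'', Summable (f κ l'') := fun κ l'' => summable_colH_colH hB hδB hC hδC hS μ z' κ l'' x z a b
  have hunc : ∀ κ l'', Summable (Function.uncurry fun w' x' => f κ l'' (w', x')) := fun κ l'' =>
    (hsum κ l'').congr (fun p => by rfl)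
  have hfibw : ∀ κ l'' x', Summable fun w' => f κ l'' (w', x') := fun κ l'' x' =>
    ((hsum κ l'').prod_symm.prod_factor x').congr (fun w' => by rfl)
  have hroww : ∀ κ l'', Summable fun w' => ∑' x', f κ l'' (w', x') := fun κ l'' => (hsum κ l'').prod
  have hrowx : ∀ κ l'', Summable fun x' => ∑' w', f κ l'' (w', x') := fun κ l'' =>
    ((hsum κ l'').prod_symm.prod).congr (fun x' => by rfl)
  have hcomm : ∀ κ l'', ∑' x', ∑' w', f κ l'' (w', x') = ∑' w', ∑' x', f κ l'' (w', x') := fun κ l'' =>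
    (hunc κ l'').tsum_comm
  -- the left-hand side, expanded through `hcol`
  have hL : vertexOfK A N' S μ z' x z a b = ∑ κ, ∑ l'', ∑' x', ∑' w', f κ l'' (w', x') := by
    simp only [vertexOfK, wsum]
    refine Finset.sum_congr rfl fun κ _ => ?_
    have hstep : ∀ x', colH A N' μ z' κ x' * S κ x' x z a b = ∑ l'', ∑' w', f κ l'' (w', x') := fun x' => by
      rw [hcol μ z' κ x', ← tsum_mul_right, ← Summable.tsum_finsetSum (fun l'' _ => hfibw κ l'' x')]
      refine tsum_congr fun w' => ?_
      rw [Finset.sum_mul]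
      refine Finset.sum_congr rfl fun l'' _ => ?_
      simp only [hf]
      ring
    simp_rw [hstep]
    exact Summable.tsum_finsetSum (fun l'' _ => hrowx κ l'')
  -- the right-hand side, expanded by bilinearity
  have hR : vertexOfK C M (vertexOfK B L S) μ z' x z a b = ∑ l'', ∑ κ, ∑' w', ∑' x', f κ l'' (w', x') := by
    simp only [vertexOfK, wsum]
    refine Finset.sum_congr rfl fun l'' _ => ?_
    have hstep : ∀ w', colH C M μ z' l'' w' * ∑ κ, ∑' x', colH B L l'' w' κ x' * S κ x' x z a b
        = ∑ κ, ∑' x', f κ l'' (w', x') := fun w' => by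
      rw [Finset.mul_sum]
      refine Finset.sum_congr rfl fun κ _ => ?_
      rw [← tsum_mul_left]
      refine tsum_congr fun x' => ?_
      simp only [hf]
      ring
    simp_rw [hstep]
    exact Summable.tsum_finsetSum (fun κ _ => hroww κ l'')
  rw [hL, hR, Finset.sum_comm]
  refine Finset.sum_congr rfl fun l'' _ => Finset.sum_congr rfl fun κ _ => ?_
  exact hcomm κ l''

/-- [folklore] **THE BI-VERTEX NESTS THE SAME WAY** (`vertex2OfK K N S₂ μ y ν y′ := vertexOfK K N (κ u ↦ vertexOfK K N (S₂ κ u) ν y′) μ y`): under the same column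
semigroup, for a uniformly bounded bi-stencil family `S₂` whose inner vertices through `B` are uniformly bounded too (`hV`: the only analytic input — any
`VertexFamily` bound of `vertexOfK B L (S₂ κ u)` uniform in `(κ, u)` gives it), `vertex2OfK A N′ S₂ μ y ν y′ = vertexOfK C M (vertexOfK B L (κ u ↦ vertexOfK C M
(vertexOfK B L (S₂ κ u)) ν y′)) μ y` — both bond slots read through `B`'s columns, then `C`'s. -/
theorem vertex2OfK_nest_of_columns (hB : Decays B CB δB) (hδB : 0 < δB) (hC : Decays C CC δC) (hδC : 0 < δC)
    {S₂ : Fin (d + 1) → (Fin (d + 1) → ℤ) → Fin (d + 1) → (Fin (d + 1) → ℤ) → MKer (d + 1) (Fib d)} {C2 CV : ℝ}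
    (hS₂ : ∀ κ u κ' u' x z a b, |S₂ κ u κ' u' x z a b| ≤ C2)
    (hV : ∀ (ν : Fin (d + 1)) (y' : Fin (d + 1) → ℤ) κ u x z a b, |vertexOfK A N' (S₂ κ u) ν y' x z a b| ≤ CV)
    (hcol : ∀ (μ : Fin (d + 1)) (z' : Fin (d + 1) → ℤ) (κ : Fin (d + 1)) (x' : Fin (d + 1) → ℤ),
      colH A N' μ z' κ x' = ∑' w' : Fin (d + 1) → ℤ, ∑ l'' : Fin (d + 1), colH B L l'' w' κ x' * colH C M μ z' l'' w')
    (μ : Fin (d + 1)) (y : Fin (d + 1) → ℤ) (ν : Fin (d + 1)) (y' : Fin (d + 1) → ℤ) :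
    vertex2OfK A N' S₂ μ y ν y'
      = vertexOfK C M (vertexOfK B L (fun κ u => vertexOfK C M (vertexOfK B L (S₂ κ u)) ν y')) μ y := by
  unfold vertex2OfK
  have hin : (fun κ u => vertexOfK A N' (S₂ κ u) ν y') = fun κ u => vertexOfK C M (vertexOfK B L (S₂ κ u)) ν y' :=
    funext fun κ => funext fun u => vertexOfK_nest_of_columns hB hδB hC hδC (hS₂ κ u) hcol ν y'
  rw [← hin]
  exact vertexOfK_nest_of_columns hB hδB hC hδC (S := fun κ u => vertexOfK A N' (S₂ κ u) ν y') (fun κ u => hV ν y' κ u) hcol μ y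

end Generic

/-! ## §2 The undressed perfect resolvents: (K-fm) nests the vertices (`d + 1 = 4`, `Lc ≥ 2`, `m ≥ 1`) -/

section Perfect

variable {Lc : ℕ} [NeZero Lc]

/-- [folklore] A local stencil family with a nonnegative rate is uniformly bounded by its constant. -/
theorem abs_le_of_locStencil {d : ℕ} {S : Fin (d + 1) → (Fin (d + 1) → ℤ) → MKer (d + 1) (Fib d)} {Cs δs : ℝ}
    (hS : OneStepResolventKernel.LocStencil S Cs δs) (hδs : 0 ≤ δs) (κ : Fin (d + 1)) (u x z : Fin (d + 1) → ℤ) (a b : Fib d) :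
    |S κ u x z a b| ≤ Cs := by
  have hCs : 0 ≤ Cs := (hS κ u).nonneg (Sum.inl 0)
  refine (hS κ u x z a b).trans ?_
  have hexp : Real.exp (-δs * (l1 (x - u) + l1 (z - u))) ≤ 1 := by
    rw [Real.exp_le_one_iff]
    nlinarith [l1_nonneg (x - u), l1_nonneg (z - u)]
  nlinarith

/-- [our object] **(K-fm) IN COLUMN FORM**: the OWNER's `PerfectColumnSemigroup.kPerf_column_semigroup` read through an4's `colH` —
`colH (KPerf (m+1)) (Lc^(m+1)) μ z′ κ x′ = Σ'_{w′} Σ_{l″} colH (KPerf 1) Lc l″ w′ κ x′ · colH (KPerf m) (Lc^m) μ z′ l″ w′` (adopted units, scalar exactly `1`). -/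
theorem colH_KPerf_succ_eq (hLc : 2 ≤ Lc) {m : ℕ} (hm : 1 ≤ m) (μ : Fin (3 + 1)) (z' : Fin (3 + 1) → ℤ) (κ : Fin (3 + 1))
    (x' : Fin (3 + 1) → ℤ) :
    colH (KPerf (d := 3) Lc (sfStep Lc) (smStep 3 Lc) (m + 1)) (Lc ^ (m + 1)) μ z' κ x'
      = ∑' w' : Fin (3 + 1) → ℤ, ∑ l'' : Fin (3 + 1),
          colH (KPerf (d := 3) Lc (sfStep Lc) (smStep 3 Lc) 1) Lc l'' w' κ x'
            * colH (KPerf (d := 3) Lc (sfStep Lc) (smStep 3 Lc) m) (Lc ^ m) μ z' l'' w' := by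
  simp only [colH]
  exact kPerf_column_semigroup Lc hLc hm κ μ x' z'

/-- [our object] **THE `(m+1)`-FOLD PERFECT VERTEX IS THE `m`-FOLD VERTEX OF THE ONE-STEP VERTICES** (UNDRESSED perfect resolvents, adopted units; any uniformly
bounded stencil family `S` — in particular any `LocStencil` family, `abs_le_of_locStencil`):
`vertexOfK (KPerf (m+1)) (Lc^(m+1)) S μ z′ = vertexOfK (KPerf m) (Lc^m) (vertexOfK (KPerf 1) Lc S) μ z′`.  §1 at (K-fm). -/
theorem vertexOfK_KPerf_succ_eq_nest (hLc : 2 ≤ Lc) {m : ℕ} (hm : 1 ≤ m)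
    {S : Fin (3 + 1) → (Fin (3 + 1) → ℤ) → MKer (3 + 1) (Fib 3)} {Cs : ℝ} (hS : ∀ κ u x z a b, |S κ u x z a b| ≤ Cs)
    (μ : Fin (3 + 1)) (z' : Fin (3 + 1) → ℤ) :
    vertexOfK (KPerf (d := 3) Lc (sfStep Lc) (smStep 3 Lc) (m + 1)) (Lc ^ (m + 1)) S μ z'
      = vertexOfK (KPerf (d := 3) Lc (sfStep Lc) (smStep 3 Lc) m) (Lc ^ m)
          (vertexOfK (KPerf (d := 3) Lc (sfStep Lc) (smStep 3 Lc) 1) Lc S) μ z' := by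
  obtain ⟨C1, δ1, hδ1, hK1⟩ := exists_decays_KPerf_holds (Lc := Lc) hLc (le_refl 1)
  obtain ⟨Cm, δm, hδm, hKm⟩ := exists_decays_KPerf_holds (Lc := Lc) hLc hm
  exact vertexOfK_nest_of_columns hK1 hδ1 hKm hδm hS (colH_KPerf_succ_eq hLc hm) μ z'

/-- [our object] **THE SAME FOR A LOCAL STENCIL FAMILY** (`LocStencil S Cs δs`, `0 ≤ δs`). -/
theorem vertexOfK_KPerf_succ_eq_nest_of_locStencil (hLc : 2 ≤ Lc) {m : ℕ} (hm : 1 ≤ m)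
    {S : Fin (3 + 1) → (Fin (3 + 1) → ℤ) → MKer (3 + 1) (Fib 3)} {Cs δs : ℝ} (hS : OneStepResolventKernel.LocStencil S Cs δs) (hδs : 0 ≤ δs)
    (μ : Fin (3 + 1)) (z' : Fin (3 + 1) → ℤ) :
    vertexOfK (KPerf (d := 3) Lc (sfStep Lc) (smStep 3 Lc) (m + 1)) (Lc ^ (m + 1)) S μ z'
      = vertexOfK (KPerf (d := 3) Lc (sfStep Lc) (smStep 3 Lc) m) (Lc ^ m)
          (vertexOfK (KPerf (d := 3) Lc (sfStep Lc) (smStep 3 Lc) 1) Lc S) μ z' :=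
  vertexOfK_KPerf_succ_eq_nest hLc hm (fun κ u x z a b => abs_le_of_locStencil hS hδs κ u x z a b) μ z'

/-- [our object] **THE `(m+1)`-FOLD PERFECT BI-VERTEX NESTS** (UNDRESSED perfect resolvents, adopted units): for a uniformly bounded bi-stencil family `S₂` whose
`(m+1)`-fold inner vertices are uniformly bounded (`hV`; e.g. from an4's `vertexFamily_vertexOfK` when each `S₂ κ u` is a local stencil family with one constant),
`vertex2OfK (KPerf (m+1)) (Lc^(m+1)) S₂ μ y ν y′ = vertexOfK (KPerf m) (Lc^m) (vertexOfK (KPerf 1) Lc (κ u ↦ vertexOfK (KPerf m) (Lc^m) (vertexOfK (KPerf 1) Lc (S₂ κ u)) ν y′)) μ y`. -/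
theorem vertex2OfK_KPerf_succ_eq_nest (hLc : 2 ≤ Lc) {m : ℕ} (hm : 1 ≤ m)
    {S₂ : Fin (3 + 1) → (Fin (3 + 1) → ℤ) → Fin (3 + 1) → (Fin (3 + 1) → ℤ) → MKer (3 + 1) (Fib 3)} {C2 CV : ℝ}
    (hS₂ : ∀ κ u κ' u' x z a b, |S₂ κ u κ' u' x z a b| ≤ C2)
    (hV : ∀ (ν : Fin (3 + 1)) (y' : Fin (3 + 1) → ℤ) κ u x z a b,
      |vertexOfK (KPerf (d := 3) Lc (sfStep Lc) (smStep 3 Lc) (m + 1)) (Lc ^ (m + 1)) (S₂ κ u) ν y' x z a b| ≤ CV)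
    (μ : Fin (3 + 1)) (y : Fin (3 + 1) → ℤ) (ν : Fin (3 + 1)) (y' : Fin (3 + 1) → ℤ) :
    vertex2OfK (KPerf (d := 3) Lc (sfStep Lc) (smStep 3 Lc) (m + 1)) (Lc ^ (m + 1)) S₂ μ y ν y'
      = vertexOfK (KPerf (d := 3) Lc (sfStep Lc) (smStep 3 Lc) m) (Lc ^ m)
          (vertexOfK (KPerf (d := 3) Lc (sfStep Lc) (smStep 3 Lc) 1) Lc (fun κ u =>
            vertexOfK (KPerf (d := 3) Lc (sfStep Lc) (smStep 3 Lc) m) (Lc ^ m)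
              (vertexOfK (KPerf (d := 3) Lc (sfStep Lc) (smStep 3 Lc) 1) Lc (S₂ κ u)) ν y')) μ y := by
  obtain ⟨C1, δ1, hδ1, hK1⟩ := exists_decays_KPerf_holds (Lc := Lc) hLc (le_refl 1)
  obtain ⟨Cm, δm, hδm, hKm⟩ := exists_decays_KPerf_holds (Lc := Lc) hLc hm
  exact vertex2OfK_nest_of_columns hK1 hδ1 hKm hδm hS₂ hV (colH_KPerf_succ_eq hLc hm) μ y ν y'

end Perfect


end Summit.QuantumFields.BalabanUV.Beta.FP.ColumnSemigroupVertexNesting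

end
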